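import Summits.CriticalPhenomena.PercolationContinuityZ3.Theorems.PercNearOneGluingNoHeavyLowerTailAntitheticVectorCert
import HarnessLib

/-!
# `NoHeavyLowerTail` (stmt-CriticalPhenomena-4575) — antithetic cluster pairs: vector-form certificates, COUNT form (prim-hp-2 gen 58)

Support file (`--supports stmt-CriticalPhenomena-4575`, hull-port prover `prim-hp-2`, gen 58).  No definitions, no named facts, no sorries.
`Antithetic.Cert.oplus_of_vector_cert_count`: the same certificate theorem as `Antithetic.Cert.oplus_of_vector_cert` (…AntitheticVectorCert) but
with the cover equation stated through `Multiset.count z (D.val.map π)` instead of `(D.filter (π · = z)).card`.  Reason: when the hypothesis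
is discharged by `native_decide`, the map `π` (two cluster computations) is then evaluated ONCE per colouring (the mapped multiset is a closed
subterm) instead of once per colouring AND per value `z`; for instances with 2^13 sub-colourings this is the difference between seconds and
a time-out (HOME/MEMO-gen58 §4 P3').
[cite: VandenbergHaggstromKahn2005, §1 p. 6 ("Harris' inequality")]
-/

noncomputable section

namespace Summit.CriticalPhenomena.PercolationContinuityZ3.Theorems

namespace Antithetic

namespace Cert

variable {α : Type*} {V : Type*} [DecidableEq V]

/-- Fibre cardinality as a multiset count. [folklore] -/
theorem card_filter_eq_count_map (D : Finset α) (π : α → Finset V × Finset V) (z : Finset V × Finset V) :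
    (D.filter fun a => π a = z).card = (D.val.map π).count z := by
  rw [Multiset.count_map, Finset.card_def, Finset.filter_val]
  congr 1
  exact Multiset.filter_congr fun a _ => eq_comm

/-- **Vector-form certificate theorem, count form** (see …AntitheticVectorCert). [this work] -/
theorem oplus_of_vector_cert_count (D : Finset α) (π : α → Finset V × Finset V) (L : ℕ) (hL : 0 < L) {k1 k0 k2 : ℕ}
    (BOT TOP : Fin k1 → Finset V × Finset V) (W1 : Fin k1 → ℕ) (PT0 : Fin k0 → Finset V × Finset V) (W0 : Fin k0 → ℕ)
    (QA QB QC QD : Fin k2 → Finset V × Finset V) (W2 : Fin k2 → ℕ)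
    (hcover : (D.image π).filter (fun z => L * (D.val.map π).count z ≠
      (∑ i : Fin k1, W1 i * ((if BOT i = z then 1 else 0) + (if TOP i = z then 1 else 0))) +
        (∑ j : Fin k0, W0 j * (if PT0 j = z then 1 else 0)) +
        ∑ m : Fin k2, W2 m * ((if QA m = z then 1 else 0) + (if QB m = z then 1 else 0) + (if QC m = z then 1 else 0) +
          (if QD m = z then 1 else 0))) = ∅)
    (hmem : (∀ i : Fin k1, BOT i ∈ D.image π ∧ TOP i ∈ D.image π) ∧ (∀ j : Fin k0, PT0 j ∈ D.image π) ∧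
      (∀ m : Fin k2, QA m ∈ D.image π ∧ QB m ∈ D.image π ∧ QC m ∈ D.image π ∧ QD m ∈ D.image π))
    (hok : (∀ i : Fin k1, (BOT i).1 ⊆ (TOP i).1 ∧ (TOP i).2 ⊆ (BOT i).2 ∧ (TOP i).2 ⊆ (BOT i).1 ∧ (BOT i).2 ⊆ (TOP i).1) ∧
      (∀ j : Fin k0, (PT0 j).2 ⊆ (PT0 j).1) ∧
      (∀ m : Fin k2, ((QA m).1 ⊆ (QB m).1 ∧ (QB m).2 ⊆ (QA m).2) ∧ ((QA m).1 ⊆ (QC m).1 ∧ (QC m).2 ⊆ (QA m).2) ∧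
        ((QB m).1 ⊆ (QD m).1 ∧ (QD m).2 ⊆ (QB m).2) ∧ ((QC m).1 ⊆ (QD m).1 ∧ (QD m).2 ⊆ (QC m).2) ∧
        ((QD m).2 ⊆ (QA m).1 ∧ (QA m).2 ⊆ (QD m).1) ∧ ((QC m).2 ⊆ (QB m).1 ∧ (QB m).2 ⊆ (QC m).1)))
    {K₁ K₂ : Set V → Set V → ℝ}
    (hK₁ : ∀ ⦃A A' B B' : Set V⦄, A ⊆ A' → B' ⊆ B → K₁ A B ≤ K₁ A' B') (hso₁ : ∀ A B, 0 ≤ K₁ A B + K₁ B A)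
    (hK₂ : ∀ ⦃A A' B B' : Set V⦄, A ⊆ A' → B' ⊆ B → K₂ A B ≤ K₂ A' B') (hso₂ : ∀ A B, 0 ≤ K₂ A B + K₂ B A) :
    0 ≤ ∑ a ∈ D, K₁ (↑(π a).1) (↑(π a).2) * K₂ (↑(π a).1) (↑(π a).2) := by
  refine oplus_of_vector_cert D π L hL BOT TOP W1 PT0 W0 QA QB QC QD W2 ?_ hmem hok hK₁ hso₁ hK₂ hso₂
  rw [Finset.filter_eq_empty_iff] at hcover ⊢
  intro z hz
  rw [card_filter_eq_count_map]
  exact hcover hz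

end Cert

end Antithetic

end Summit.CriticalPhenomena.PercolationContinuityZ3.Theorems
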